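import Summits.CriticalPhenomena.PercolationContinuityZ3.Theorems.Transplant.Slab111VPlan
import HarnessLib

/-!
# The routing certificate for `ShapedLinkage 3 (Slab111.hexShadow k)`, I′: a FAST MIRROR of the checker (kernel / native evaluation), part A

builds on p205010 (kernel theorem, internal audit signed; external expert review pending) — NOT used in this file.  Lane `prim-bschramm`, seat
`prim-bschramm-p2` (gen 35; class C1b; memo `HOME/bschramm/P2-LATTICES.md` §129); helper file (`--supports stmt-CriticalPhenomena-4575 --as helper`).
The checker «Slab111VPlan» reads the block's peel codes by scanning the peel table (`Ctx.hasCode`) and tests columns / vertices by list scans; the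
certificate evaluates the checker millions of times, where such scans dominate.  This file and «Slab111VFastB» mirror every function of the checker that
reads the context or scans lists, with `O(1)` table lookups (`CtxT`: a complete binary tree over the `64` column indices of `[−3,3]²`) and bitmask tests,
and prove each mirror EQUAL to — or, for the mask-based tests, IMPLYING — its original; the certificate uses the mirrors, the soundness theorems the
originals.
* §1 the column table `CT`, `CtxT.of`, `hasCodeT_eq`;
* §2 column mirrors `colWT`, `colRWT`, `AttD.okT`, `TermD.okT` (equalities), bit lemmas for or-folds, and the mask-based validity test `validOKT` with
  `validOK_of_validOKT`.
-/

namespace Summit.CriticalPhenomena.PercolationContinuityZ3.Theorems.Transplant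

namespace Slab111

/-! ## §1 The column table -/

/-- Decode a column index `(a+3)·8 + (b+3)`. [folklore] -/
def cdec (i : ℕ) : Col := (((i / 8 : ℕ) : ℤ) - 3, ((i % 8 : ℕ) : ℤ) - 3)

/-- Column index of a relative column in `[−3,3]²` (as in «Slab111VSearch»). [folklore] -/
def cidxT (q : Col) : ℕ := ((q.1 + 3) * 8 + (q.2 + 3)).toNat

/-- A complete binary tree of per-column peel-table excerpts. [folklore] -/
inductive CT where
  /-- the peel-table entries of one column -/
  | leaf : List ((ℤ × ℤ) × ℕ) → CT
  /-- lower half, upper half -/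
  | node : CT → CT → CT

/-- Build the tree over the indices `off … off + 2^d − 1`. [folklore] -/
def CT.mk (tab : List ((ℤ × ℤ) × ℕ)) : ℕ → ℕ → CT
  | 0, off => CT.leaf (tab.filter fun e => e.1 == cdec off)
  | d + 1, off => CT.node (CT.mk tab d off) (CT.mk tab d (off + 2 ^ d))

/-- Look an index up. [folklore] -/
def CT.get : CT → ℕ → ℕ → ℕ → List ((ℤ × ℤ) × ℕ)
  | CT.leaf l, _, _, _ => l
  | CT.node l r, d + 1, off, i => if i < off + 2 ^ d then l.get d off i else r.get d (off + 2 ^ d) i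
  | CT.node l _, 0, off, i => l.get 0 off i

/-- The lookup returns the excerpt of the column with the given index. [folklore] -/
theorem CT.get_mk (tab : List ((ℤ × ℤ) × ℕ)) : ∀ (d off i : ℕ), off ≤ i → i < off + 2 ^ d →
    (CT.mk tab d off).get d off i = tab.filter fun e => e.1 == cdec i
  | 0, off, i, h1, h2 => by
    have : i = off := by simp at h2; omega
    subst this; rfl
  | d + 1, off, i, h1, h2 => by
    show (if i < off + 2 ^ d then (CT.mk tab d off).get d off i else (CT.mk tab d (off + 2 ^ d)).get d (off + 2 ^ d) i) = _
    split_ifs with h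
    · exact CT.get_mk tab d off i h1 h
    · exact CT.get_mk tab d (off + 2 ^ d) i (by omega) (by rw [pow_succ] at h2; omega)

/-- **Fast context**: the checking context with its column table and the masks of usable columns. [folklore] -/
structure CtxT where
  /-- the checking context -/
  C : Ctx
  /-- per-column excerpts of `C.tab`, indexed by `cidxT` -/
  tree : CT
  /-- mask (over `cidxT`) of the columns usable by the rerouted piece (`colRW`) -/
  mRW : ℕ
  /-- mask of the columns usable by the branches (`colW`) -/
  mW : ℕ

/-- Mask of the column indices `< 64` whose column satisfies `p`. [folklore] -/
def pmask (p : Col → Bool) : ℕ := (List.range 64).foldl (fun acc i => if p (cdec i) then acc ||| 2 ^ i else acc) 0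

/-- Build the fast context. [folklore] -/
def CtxT.of (C : Ctx) : CtxT := ⟨C, CT.mk C.tab 6 0, pmask (colRW C), pmask (colW C)⟩

/-- **Fast peel-code lookup** (falls back to the scan outside `[−3,3]²`). [folklore] -/
def CtxT.hasCodeT (T : CtxT) (q : Col) (code : ℕ) : Bool :=
  if -3 ≤ q.1 ∧ q.1 ≤ 3 ∧ -3 ≤ q.2 ∧ q.2 ≤ 3 then (T.tree.get 6 0 (cidxT q)).any fun e => e.2 == code else T.C.hasCode q code

/-- Decoding the index of a column in range gives the column back. [folklore] -/
theorem cdec_cidxT {q : Col} (h : -3 ≤ q.1 ∧ q.1 ≤ 3 ∧ -3 ≤ q.2 ∧ q.2 ≤ 3) : cdec (cidxT q) = q := by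
  obtain ⟨a, b⟩ := q
  simp only at h
  obtain ⟨h1, h2, h3, h4⟩ := h
  simp only [cdec, cidxT, Prod.mk.injEq]
  constructor <;> omega

/-- The index of a column in range is `< 64`. [folklore] -/
theorem cidxT_lt {q : Col} (h : -3 ≤ q.1 ∧ q.1 ≤ 3 ∧ -3 ≤ q.2 ∧ q.2 ≤ 3) : cidxT q < 64 := by
  obtain ⟨a, b⟩ := q; simp only at h; simp only [cidxT]; omega

/-- **The fast lookup equals the scan.** [folklore] -/
theorem hasCodeT_eq (C : Ctx) (q : Col) (code : ℕ) : (CtxT.of C).hasCodeT q code = C.hasCode q code := by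
  unfold CtxT.hasCodeT
  split_ifs with h
  · show ((CT.mk C.tab 6 0).get 6 0 (cidxT q)).any _ = _
    rw [CT.get_mk C.tab 6 0 (cidxT q) (Nat.zero_le _) (by have := cidxT_lt h; simpa using this), cdec_cidxT h, Ctx.hasCode,
      List.any_filter]
  · rfl

/-! ## §2 The mirrors -/

/-- Mirror of `noCode4`. [folklore] -/
def noCode4T (T : CtxT) (q : Col) : Bool := !T.hasCodeT q 4
/-- Mirror of `colW`. [folklore] -/
def colWT (T : CtxT) (q : Col) : Bool := inBlkB T.C.K.tD T.C.K.sD q && noCode4T T q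
/-- Mirror of `colRW`. [folklore] -/
def colRWT (T : CtxT) (q : Col) : Bool := inBlkB T.C.K.tR T.C.K.sR q && colWT T q

/-- `colWT` equals `colW`. [folklore] -/
theorem colWT_eq (C : Ctx) (q : Col) : colWT (CtxT.of C) q = colW C q := by
  simp only [colWT, noCode4T, hasCodeT_eq, colW, noCode4]; rfl
/-- `colRWT` equals `colRW`. [folklore] -/
theorem colRWT_eq (C : Ctx) (q : Col) : colRWT (CtxT.of C) q = colRW C q := by
  simp only [colRWT, colWT_eq, colRW]; rfl

/-- Mirror of `AttD.ok`. [folklore] -/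
def AttD.okT (T : CtxT) (roleE : Bool) (a : AttD) : Bool :=
  decide a.F.ok && a.fcols.all (fun q => if roleE then colRWT T q else colWT T q) &&
  (if roleE then colRWT T a.c else colWT T a.c) &&
  ((a.ext == 0 && a.fcols.contains a.c) || (a.ext == -1 && !a.fcols.contains a.c && isUpB a.tcol a.c) ||
    (a.ext == 1 && !a.fcols.contains a.c && isUpB a.c a.tcol))

/-- `AttD.okT` equals `AttD.ok`. [folklore] -/
theorem AttD.okT_eq (C : Ctx) (roleE : Bool) (a : AttD) : a.okT (CtxT.of C) roleE = a.ok C roleE := by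
  simp only [AttD.okT, AttD.ok, colWT_eq, colRWT_eq]

/-- Mirror of `TermD.ok`. [folklore] -/
def TermD.okT (T : CtxT) (roleE : Bool) : TermD → Bool
  | TermD.exact v => vOK v && (if roleE then colRWT T v.1 else colWT T v.1)
  | TermD.ride a _ => a.okT T roleE

/-- `TermD.okT` equals `TermD.ok`. [folklore] -/
theorem TermD.okT_eq (C : Ctx) (roleE : Bool) (t : TermD) : t.okT (CtxT.of C) roleE = t.ok C roleE := by
  cases t <;> simp only [TermD.okT, TermD.ok, colWT_eq, colRWT_eq, AttD.okT_eq]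

/-- Column in `[−3,3]²` (Boolean). [folklore] -/
def inR (q : Col) : Bool := decide (-3 ≤ q.1) && decide (q.1 ≤ 3) && decide (-3 ≤ q.2) && decide (q.2 ≤ 3)

/-- Column mask of a list of model vertices. [folklore] -/
def colMask (l : List MV) : ℕ := l.foldl (fun acc w => acc ||| 2 ^ cidxT w.1) 0

/-- Bits of an unconditional or-fold. [folklore] -/
theorem testBit_foldl_or {α : Type} (g : α → ℕ) : ∀ (l : List α) (init j : ℕ),
    (l.foldl (fun acc x => acc ||| 2 ^ g x) init).testBit j = (init.testBit j || l.any fun x => g x == j)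
  | [], init, j => by simp
  | x :: l, init, j => by
    rw [List.foldl_cons, testBit_foldl_or g l, Nat.testBit_or, Nat.testBit_two_pow, List.any_cons]
    cases init.testBit j <;> cases l.any (fun x => g x == j) <;> by_cases h : g x = j <;> simp [h]

/-- Bits of a conditional or-fold. [folklore] -/
theorem testBit_foldl_cond (p : ℕ → Bool) : ∀ (l : List ℕ) (init j : ℕ),
    (l.foldl (fun acc i => if p i then acc ||| 2 ^ i else acc) init).testBit j = (init.testBit j || l.any fun i => p i && i == j)
  | [], init, j => by simp
  | i :: l, init, j => by
    rw [List.foldl_cons, testBit_foldl_cond p l, List.any_cons]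
    by_cases hp : p i = true
    · rw [if_pos hp, Nat.testBit_or, Nat.testBit_two_pow, hp]
      cases init.testBit j <;> cases l.any (fun i => p i && i == j) <;> by_cases h : i = j <;> simp [h]
    · rw [if_neg hp]; simp [hp]

/-- A vertex of a list has its column bit in the list's column mask. [folklore] -/
theorem testBit_colMask {l : List MV} {w : MV} (hw : w ∈ l) : (colMask l).testBit (cidxT w.1) = true := by
  rw [colMask, testBit_foldl_or]
  simp only [Nat.zero_testBit, Bool.false_or, List.any_eq_true, beq_iff_eq]
  exact ⟨w, hw, rfl⟩

/-- A set bit of `pmask p` is a column index `< 64` whose column satisfies `p`. [folklore] -/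
theorem of_testBit_pmask {p : Col → Bool} {j : ℕ} (h : (pmask p).testBit j = true) : p (cdec j) = true := by
  rw [pmask, testBit_foldl_cond] at h
  simp only [Nat.zero_testBit, Bool.false_or, List.any_eq_true, Bool.and_eq_true, beq_iff_eq] at h
  obtain ⟨i, -, hp, rfl⟩ := h
  exact hp

/-- **Subset test of column masks**: every vertex of the list (columns in range) has a column satisfying `p`. [folklore] -/
theorem col_of_subset {p : Col → Bool} {l : List MV} (hR : ∀ w ∈ l, inR w.1 = true) (hm : (colMask l &&& pmask p == colMask l) = true)
    {w : MV} (hw : w ∈ l) : p w.1 = true := by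
  have hr : -3 ≤ w.1.1 ∧ w.1.1 ≤ 3 ∧ -3 ≤ w.1.2 ∧ w.1.2 ≤ 3 := by
    have := hR w hw; simp only [inR, Bool.and_eq_true, decide_eq_true_eq] at this; exact ⟨this.1.1.1, this.1.1.2, this.1.2, this.2⟩
  have hb := testBit_colMask hw
  rw [beq_iff_eq] at hm
  rw [← hm, Nat.testBit_and, Bool.and_eq_true] at hb
  have := of_testBit_pmask hb.2
  rwa [cdec_cidxT hr] at this

/-- **Mirror of `PlanD.validOK`** by column-mask subset tests (the per-vertex class test `vOK` is residue-independent). [folklore] -/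
def PlanD.validOKT (T : CtxT) (P : PlanD) : Bool :=
  let lR := P.A ++ P.y :: P.b :: P.B
  let lT := P.T1 ++ P.T2
  lR.all (fun w => vOK w && inR w.1) && lT.all (fun w => vOK w && inR w.1) &&
    (colMask lR &&& T.mRW == colMask lR) && (colMask lT &&& T.mW == colMask lT)

/-- `validOKT` implies `validOK`. [folklore] -/
theorem PlanD.validOK_of_validOKT (C : Ctx) (P : PlanD) (h : P.validOKT (CtxT.of C) = true) : P.validOK C = true := by
  simp only [PlanD.validOKT, Bool.and_eq_true, List.all_eq_true] at h
  obtain ⟨⟨⟨hR, hT⟩, hmR⟩, hmT⟩ := h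
  simp only [PlanD.validOK, Bool.and_eq_true, List.all_eq_true]
  exact ⟨fun w hw => ⟨(hR w hw).1, col_of_subset (p := colRW C) (fun w hw => (hR w hw).2) hmR hw⟩,
    fun w hw => ⟨(hT w hw).1, col_of_subset (p := colW C) (fun w hw => (hT w hw).2) hmT hw⟩⟩

end Slab111

end Summit.CriticalPhenomena.PercolationContinuityZ3.Theorems.Transplant
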